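import Summits.AtomisticToContinuum.BoseEinsteinCondensation.Theses.BECCovarianceTransport

/-!
# Birth skeleton (BC3) for the crux `HardModeBounds` (stmt-AtomisticToContinuum-12685)

Route `BECCovarianceTransport` (rank-4 crux; wanted by this route only); planner skeleton
`Lines/birth.lean` (planner-skel-stmt-AtomisticToContinuum-12685-0, 2026-08-17).

**The crux.** `HardModeBounds`: for every repulsive finite-range `v` there are `C, ρ₀ > 0` such
that for `0 < ρ < ρ₀`, eventually in `M` (torus of side `L = ((M+2)/ρ)^{1/3}`, `N = M + 2`
particles, `a` = scattering length, `c = √(16πρa)`, `κ = 1/ξ = √(8πρa)`, `Φ_t` = the torus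
imaginary-time Feynman–Kac flow of the constant function, `Z(t) = ∫_{cell^N} Φ_t²`), for every
finite set `S` of HARD plane-wave modes (`|k_n| > κ`) and every `t ≥ C c⁻²`:
`⟨N_S⟩_t ≤ C N √(ρa³)` and `⟨N_S²⟩_t ≤ ⟨N_S⟩_t² + C N` (occupation `occ S t`, pair occupation
`pair S t`, exactly the `let`-block of the route decl).

**The line (two named stubs = the two mechanisms the route itself foresees, cut along TIME).**
The route's two-layer plan reads "HardModeBounds ⇐ (cluster expansion for t ≤ Kξ² delivering
the bounds at t = Kξ²) → (propagation to t ≥ Kξ²)", and its why-it-might-fail names exactly the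
second step ("t ≲ ξ² is inside a Ginibre cluster radius ρat ≲ 1, uniform propagation beyond is
unproved"). The skeleton types the two steps as independent propositions over the SAME
`let`-block as the crux (so that the composition is function application up to ζ-reduction):

* `stub_clusterWindow : Sig.stub_clusterWindow` — INSIDE THE CLUSTER RADIUS. For every admissible
  `v` there are `0 < C₀ ≤ K`, `C₁ > 0`, `ρ₀ > 0` such that for `0 < ρ < ρ₀`, eventually in `M`, the
  two hard-mode bounds hold with constant `C₁` for every hard `S` and every `t` in the window
  `C₀ c⁻² ≤ t ≤ K c⁻²`. Since `c⁻² = 1/(16πρa)`, the window sits at `ρ a t ∈ [C₀, K]/(16π)`: a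
  bounded expected number of partners met by a world-line (`∝ ρ a t`), i.e. the convergent regime of a
  Ginibre-type cluster expansion of the `2t`-long interacting Brownian paths with constant
  (Boltzmann, permutation-free) initial law; heuristically the LHY size `N√(ρa³)` is the two-body
  depletion cloud `≈ 4πρa²√t` per particle while `√t ≲ ξ`, saturating for `t ≳ ξ² = 2c⁻²` at
  `O(1)·√(ρa³)`. The prover chooses the window (even `K = C₀`, a single
  instant, is admissible — the statement is then still the uniform-in-`L` LHY-order bound for an
  interacting `N`-body Feynman–Kac state at a time of order `c⁻²`). Size XL.
* `stub_propagation : Sig.stub_propagation` — BEYOND THE CLUSTER RADIUS. For every admissible `v`,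
  every window `0 < C₀ ≤ K` and every `C₁ > 0` there are `K₂ ≥ K` and `C₂, ρ₁ > 0` such that for
  `0 < ρ < ρ₁`, eventually in `M`: IF the two bounds hold with constant `C₁` for every hard `S`
  on the window `[C₀ c⁻², K c⁻²]`, THEN they hold with constant `C₂` for every hard `S` and every
  `t ≥ K₂ c⁻²` (all later times up to a transient `[K, K₂] c⁻²` the prover may skip; the intended
  proof has `K₂ = K`). This is the typed form of "propagation by the monotone structure of the flow":
  at the Bogoliubov (Riccati) level the hard occupations rise monotonically without overshoot to
  the ground-state value (`1/√2` of the Bogoliubov depletion ≈ `1.06 N√(ρa³)` above `κ`) and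
  `Var_t(N_S) ≤ 4.4 Σ_hard v_k²` for all `t ≥ 0` (refuter rattack-12685 read-back, item evidence
  `evidence_HardModeBounds_cruxattack.md`); the hard modes (`ω_k ≥ ω_κ ≈ 0.87 c²`) are relaxed by
  `t ≈ c⁻²`. The hypothesis always contains the instant `t = K c⁻²` (`C₀ ≤ K`, `c⁻² ≥ 0`), so the
  stub is never vacuously the crux. Size XL (its `t → ∞` end is the thermodynamic-limit LHY-order
  momentum bound for the torus ground state, conditioned on the finite-time input).

`HardModeBounds_of : Sig.stub_clusterWindow → Sig.stub_propagation → HardModeBounds` is PROVED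
below (no sorry): take the window `(C₀, K, C₁, ρ₀)` of stub 1, feed it to stub 2 to get
`(K₂, C₂, ρ₁)`, and set `C := max K₂ C₂`, `ρ₀' := min ρ₀ ρ₁`; for `t ≥ C c⁻² ≥ K₂ c⁻²` stub 2
(whose hypothesis is stub 1's conclusion at the same `M`, by ζ-reduction of the common
`let`-block) gives the bounds with `C₂ ≤ C`, and both right-hand sides are monotone in the
constant (`ENNReal.ofReal_le_ofReal`, `(M+2) √(ρa³) ≥ 0`).

Both stubs are CONSEQUENCES of the crux (crux with constants `(C, ρ₀)` ⇒ stub 1 with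
`C₀ = K = C₁ := C`; ⇒ stub 2 with `K₂ := max K C`, `C₂ := C`, `ρ₁ := ρ₀`, ignoring the window
hypothesis), so `stub 1 ∧ stub 2 ⟺ crux`: the pair is an honest cut of the crux, not a
strengthening of it; and neither stub is the crux or the summit in disguise: stub 1 bounds nothing
after `K c⁻²`, stub 2 is conditional on an LHY-order input no cheap argument supplies. The BC3 probes (`stub → HardModeBounds`, `stub → BoseEinsteinCondensation` by
`first | exact? | simpa | aesop`) all fail (table in `birth.md`).

Disproof used: none on file (`ledger crux ls stmt-AtomisticToContinuum-12685` = no workfiles, no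
`Disproof.lean`, no `Negative/` lemmas at registration). Honoured: the refuter's read-back
(rattack-12685: `occ`/`pair` are the first/second factorial moments of `N_S`, `Z(t) > 0` for the
positive FK integrand, `a = ⊤` impossible for finite range, `v = 0 ⇒ c = 0 ⇒ c⁻¹ = 0` so every
threshold collapses to `t ≥ 0` / `t = 0` where `Φ = 1` and all hard occupations vanish) — both
stubs keep the crux's `let`-block, thresholds `· * c⁻¹ ^ 2` and right-hand sides verbatim.
-/

open scoped BigOperators Topology Manifold Classical MeasureTheory ProbabilityTheory Matrix InnerProductSpace ComplexConjugate ContinuousMap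
open Filter Set Function TopologicalSpace MeasureTheory

namespace Summit.AtomisticToContinuum.BoseEinsteinCondensation.Cruxes.HardModeBounds.Birth

open Summit.AtomisticToContinuum.BoseEinsteinCondensation.Theses.BECCovarianceTransport
open Literature.MathematicalPhysics.QuantumManyBody.BoseGas

/-! ## Stub signatures (same `let`-block as the route decl `HardModeBounds`) -/

/-- Signature of `stub_clusterWindow`: the two hard-mode bounds with constant `C₁` on a window
`C₀ c⁻² ≤ t ≤ K c⁻²` (`0 < C₀ ≤ K`) inside the cluster radius, at small density, eventually in
`M`, for every finite set of hard modes. -/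
def Sig.stub_clusterWindow : Prop :=
  ∀ v : ℝ → ENNReal, Literature.MathematicalPhysics.QuantumManyBody.BoseGas.IsRepulsiveFiniteRange v → ∃ C₀ K C₁ ρ₀ : ℝ, 0 < C₀ ∧ C₀ ≤ K ∧ 0 < C₁ ∧ 0 < ρ₀ ∧ ∀ ρ : ℝ, 0 < ρ → ρ < ρ₀ → ∀ᶠ M : ℕ in Filter.atTop, let L : ℝ := Literature.MathematicalPhysics.QuantumManyBody.BoseGas.sideLength ρ (M + 2); let a : ℝ := (Literature.MathematicalPhysics.QuantumManyBody.BoseGas.scatteringLength v).toReal; let c : ℝ := Real.sqrt (16 * Real.pi * ρ * a); let κ : ℝ := Real.sqrt (8 * Real.pi * ρ * a); let Φ : ℝ → Literature.MathematicalPhysics.QuantumManyBody.BoseGas.Config (M + 2) → ENNReal := fun t X => ∫⁻ ω, Literature.MathematicalPhysics.QuantumManyBody.BoseGas.expNeg (∫⁻ s in Set.Ioc (0 : ℝ) t, Literature.MathematicalPhysics.QuantumManyBody.BoseGas.periodicInteraction v L (Literature.MathematicalPhysics.QuantumManyBody.BoseGas.worldLine X ω s.toNNReal)) ∂(Literature.MathematicalPhysics.QuantumManyBody.BoseGas.wienerPaths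 (M + 2)); let Z : ℝ → ENNReal := fun t => ∫⁻ X in Literature.MathematicalPhysics.QuantumManyBody.BoseGas.cellN (M + 2) L, Φ t X ^ 2; let mode : (Fin 3 → ℤ) → EuclideanSpace ℝ (Fin 3) → ℂ := fun n x => ((Real.sqrt (L ^ 3))⁻¹ : ℂ) * Literature.MathematicalPhysics.QuantumManyBody.BoseGas.cellWave L n x; let kn : (Fin 3 → ℤ) → ℝ := fun n => 2 * Real.pi * Real.sqrt (∑ k : Fin 3, ((n k : ℤ) : ℝ) ^ 2) / L; let occ : Finset (Fin 3 → ℤ) → ℝ → ENNReal := fun S t => (∑ n ∈ S, Literature.MathematicalPhysics.QuantumManyBody.BoseGas.cellOccupation (M + 2) L (mode n) (fun X => ((Φ t X).toReal : ℂ))) / Z t; let pair : Finset (Fin 3 → ℤ) → ℝ → ENNReal := fun S t => ((M + 2 : ENNReal) * (M + 1)) * (∑ n ∈ S, ∑ m ∈ S, ∫⁻ Y in Literature.MathematicalPhysics.QuantumManyBody.BoseGas.cellN M L, (‖∫ x in Literature.MathematicalPhysics.QuantumManyBody.BoseGas.cell L, ∫ y in Literature.MathematicalPhysics.QuantumManyBody.BoseGas.cell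 L, conj (mode n x) * conj (mode m y) * ((Φ t (Matrix.vecCons x (Matrix.vecCons y Y))).toReal : ℂ)‖₊ : ENNReal) ^ 2) / Z t; ∀ S : Finset (Fin 3 → ℤ), (∀ n ∈ S, κ < kn n) → ∀ t : ℝ, C₀ * c⁻¹ ^ 2 ≤ t → t ≤ K * c⁻¹ ^ 2 → occ S t ≤ ENNReal.ofReal (C₁ * (M + 2) * Real.sqrt (ρ * a ^ 3)) ∧ occ S t + pair S t ≤ occ S t ^ 2 + ENNReal.ofReal (C₁ * (M + 2))

/-- Signature of `stub_propagation`: for every window `0 < C₀ ≤ K` and constant `C₁ > 0` there are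
`K₂ ≥ K` and `C₂, ρ₁ > 0` such that at density `< ρ₁`, eventually in `M`, the two hard-mode bounds
with constant `C₁` on `[C₀ c⁻², K c⁻²]` (all hard `S`) imply the bounds with constant `C₂` for all
hard `S` and all `t ≥ K₂ c⁻²`. -/
def Sig.stub_propagation : Prop :=
  ∀ v : ℝ → ENNReal, Literature.MathematicalPhysics.QuantumManyBody.BoseGas.IsRepulsiveFiniteRange v → ∀ C₀ K C₁ : ℝ, 0 < C₀ → C₀ ≤ K → 0 < C₁ → ∃ K₂ C₂ ρ₁ : ℝ, K ≤ K₂ ∧ 0 < C₂ ∧ 0 < ρ₁ ∧ ∀ ρ : ℝ, 0 < ρ → ρ < ρ₁ → ∀ᶠ M : ℕ in Filter.atTop, let L : ℝ := Literature.MathematicalPhysics.QuantumManyBody.BoseGas.sideLength ρ (M + 2); let a : ℝ := (Literature.MathematicalPhysics.QuantumManyBody.BoseGas.scatteringLength v).toReal; let c : ℝ := Real.sqrt (16 * Real.pi * ρ * a); let κ : ℝ := Real.sqrt (8 * Real.pi * ρ * a); let Φ : ℝ → Literature.MathematicalPhysics.QuantumManyBody.BoseGas.Config (M + 2) → ENNReal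 := fun t X => ∫⁻ ω, Literature.MathematicalPhysics.QuantumManyBody.BoseGas.expNeg (∫⁻ s in Set.Ioc (0 : ℝ) t, Literature.MathematicalPhysics.QuantumManyBody.BoseGas.periodicInteraction v L (Literature.MathematicalPhysics.QuantumManyBody.BoseGas.worldLine X ω s.toNNReal)) ∂(Literature.MathematicalPhysics.QuantumManyBody.BoseGas.wienerPaths (M + 2)); let Z : ℝ → ENNReal := fun t => ∫⁻ X in Literature.MathematicalPhysics.QuantumManyBody.BoseGas.cellN (M + 2) L, Φ t X ^ 2; let mode : (Fin 3 → ℤ) → EuclideanSpace ℝ (Fin 3) → ℂ := fun n x => ((Real.sqrt (L ^ 3))⁻¹ : ℂ) * Literature.MathematicalPhysics.QuantumManyBody.BoseGas.cellWave L n x; let kn : (Fin 3 → ℤ) → ℝ := fun n => 2 * Real.pi * Real.sqrt (∑ k : Fin 3, ((n k : ℤ) : ℝ) ^ 2) / L; let occ : Finset (Fin 3 → ℤ) → ℝ → ENNReal := fun S t => (∑ n ∈ S, Literature.MathematicalPhysics.QuantumManyBody.BoseGas.cellOccupation (M + 2) L (mode n) (fun X => ((Φ t X).toReal : ℂ)))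 / Z t; let pair : Finset (Fin 3 → ℤ) → ℝ → ENNReal := fun S t => ((M + 2 : ENNReal) * (M + 1)) * (∑ n ∈ S, ∑ m ∈ S, ∫⁻ Y in Literature.MathematicalPhysics.QuantumManyBody.BoseGas.cellN M L, (‖∫ x in Literature.MathematicalPhysics.QuantumManyBody.BoseGas.cell L, ∫ y in Literature.MathematicalPhysics.QuantumManyBody.BoseGas.cell L, conj (mode n x) * conj (mode m y) * ((Φ t (Matrix.vecCons x (Matrix.vecCons y Y))).toReal : ℂ)‖₊ : ENNReal) ^ 2) / Z t; (∀ S : Finset (Fin 3 → ℤ), (∀ n ∈ S, κ < kn n) → ∀ t : ℝ, C₀ * c⁻¹ ^ 2 ≤ t → t ≤ K * c⁻¹ ^ 2 → occ S t ≤ ENNReal.ofReal (C₁ * (M + 2) * Real.sqrt (ρ * a ^ 3)) ∧ occ S t + pair S t ≤ occ S t ^ 2 + ENNReal.ofReal (C₁ * (M + 2))) → ∀ S : Finset (Fin 3 → ℤ), (∀ n ∈ S, κ < kn n) → ∀ t : ℝ, K₂ * c⁻¹ ^ 2 ≤ t → occ S t ≤ ENNReal.ofReal (C₂ * (M + 2)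 * Real.sqrt (ρ * a ^ 3)) ∧ occ S t + pair S t ≤ occ S t ^ 2 + ENNReal.ofReal (C₂ * (M + 2))

/-! ## Stubs -/

/-- stub 1 — INSIDE THE CLUSTER RADIUS (`ρ a t ≤ K/(16π)`): LHY-order occupation and normal number
variance of every finite hard set on a window of times of order `c⁻²`, uniformly in `L`
(Ginibre-type cluster expansion of the `2t`-long paths with constant initial law; size XL). -/
theorem stub_clusterWindow : Sig.stub_clusterWindow := by
  sorry

/-- stub 2 — PROPAGATION BEYOND THE CLUSTER RADIUS: bounds on a window ending at `K c⁻²` imply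
bounds (worse constant) for all `t ≥ K₂ c⁻²`, some `K₂ ≥ K`, uniformly in `L` (monotone structure
of the flow / relaxed hard modes; size XL). -/
theorem stub_propagation : Sig.stub_propagation := by
  sorry

/-! ## The glue -/

/-- Threshold bookkeeping: `K ≤ C` and `C · x² ≤ t` give `K · x² ≤ t` (`x = c⁻¹`). -/
theorem threshold_mono {K C x t : ℝ} (hKC : K ≤ C) (ht : C * x ^ 2 ≤ t) : K * x ^ 2 ≤ t :=
  le_trans (mul_le_mul_of_nonneg_right hKC (sq_nonneg x)) ht

/-- Monotonicity of the occupation right-hand side in the constant. -/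
theorem occRHS_mono {C C' m r : ℝ} (hC : C ≤ C') (hm : 0 ≤ m) :
    ENNReal.ofReal (C * m * Real.sqrt r) ≤ ENNReal.ofReal (C' * m * Real.sqrt r) :=
  ENNReal.ofReal_le_ofReal
    (mul_le_mul_of_nonneg_right (mul_le_mul_of_nonneg_right hC hm) (Real.sqrt_nonneg r))

/-- Monotonicity of the variance right-hand side in the constant. -/
theorem varRHS_mono {C C' m : ℝ} (hC : C ≤ C') (hm : 0 ≤ m) (o : ENNReal) :
    o ^ 2 + ENNReal.ofReal (C * m) ≤ o ^ 2 + ENNReal.ofReal (C' * m) :=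
  add_le_add le_rfl (ENNReal.ofReal_le_ofReal (mul_le_mul_of_nonneg_right hC hm))

/-- **Composition (kernel-checked, no sorry).** The two stubs imply the crux BY NAME: window
bounds (stub 1) are the hypothesis of propagation (stub 2) at every large `M`; the crux holds with
`C := max K₂ C₂` and `ρ₀ := min ρ₀ ρ₁`. -/
theorem HardModeBounds_of : Sig.stub_clusterWindow → Sig.stub_propagation → HardModeBounds := by
  intro h1 h2 v hv
  obtain ⟨C₀, K, C₁, ρ₀, hC₀, hC₀K, hC₁, hρ₀, h1⟩ := h1 v hv
  obtain ⟨K₂, C₂, ρ₁, -, hC₂, hρ₁, h2⟩ := h2 v hv C₀ K C₁ hC₀ hC₀K hC₁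
  refine ⟨max K₂ C₂, min ρ₀ ρ₁, lt_max_of_lt_right hC₂, lt_min hρ₀ hρ₁, fun ρ hρ hρlt => ?_⟩
  have hρ₀' : ρ < ρ₀ := lt_of_lt_of_le hρlt (min_le_left _ _)
  have hρ₁' : ρ < ρ₁ := lt_of_lt_of_le hρlt (min_le_right _ _)
  filter_upwards [h1 ρ hρ hρ₀', h2 ρ hρ hρ₁'] with M h1M h2M
  -- stub 1's conclusion at `M` is stub 2's hypothesis at `M` (same `let`-block, ζ-reduction)
  have h3 := h2M h1M
  dsimp only at h3 ⊢
  intro S hS t ht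
  have hKC : K₂ ≤ max K₂ C₂ := le_max_left _ _
  have hC : C₂ ≤ max K₂ C₂ := le_max_right _ _
  have hm : (0 : ℝ) ≤ (M : ℝ) + 2 := by positivity
  obtain ⟨hocc, hvar⟩ := h3 S hS t (threshold_mono hKC ht)
  exact ⟨hocc.trans (occRHS_mono hC hm), hvar.trans (varRHS_mono hC hm _)⟩

end Summit.AtomisticToContinuum.BoseEinsteinCondensation.Cruxes.HardModeBounds.Birth
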